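import Mathlib
import Summits.ValiantsHypothesis.ValiantsHypothesis.Theorems.LacunarySymmetroidMatrixDescartesGramDualHaynsworth

/-!
# `MatrixDescartes` (stmt-ValiantsHypothesis-18050) — Gram duality, part 15: THE INERTIA DUALITY — at every scale
# `x > 0` the negative index of the word and the POSITIVE index of its dual differ by a constant

HONEST FRAMING.  Cell `pub-symmetroid`, seat `val-sym-mdr-p2` (gen 19); helper file `--supports` the crux
`Theses.LacunarySymmetroid.MatrixDescartes` (OPEN), NO closure claim; companion of `…GramDualHaynsworth` and of the
Gram-duality files (`…GramDualSigned`: the word `X^eB + U diag(σX^δ) Uᵀ` and its dual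
`diag(σ⁻¹X^{E−δ}) + X^{E−e}·UᵀB⁻¹U` have the same positive zeros).  It upgrades «same zeros» to «same inertia walk»,
so the inertia calculus of `…Inertia*` (types of roots, index formula) transfers between a word and its dual.
Nothing here bears on the crux in its window, `stub_twoSided`, `DoorA26` / `DoorA34`, registers, or `VP ≠ VNP`.

**THEOREM (`negIndex_word_add_eq`, `posIndex_word_add_eq` — INERTIA DUALITY).**  `B` real symmetric with
`det B ≠ 0`, `U : ι × ρ` real, signs `σⱼ ≠ 0`, exponents `e, δⱼ ≤ E`, and a scale `x > 0`.  With the evaluated word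
`F = x^e B + U diag(σⱼx^{δⱼ}) Uᵀ` and the evaluated dual `𝔻 = diag(σⱼ⁻¹x^{E−δⱼ}) + x^{E−e}·UᵀB⁻¹U`:

  `ν(F) + #{j : 0 < σⱼ} = ν(B) + π(𝔻)`,   `π(F) + #{j : σⱼ < 0} = π(B) + ν(𝔻)`.

So along `x` the negative-index walk of the word IS the positive-index walk of the dual (up to the constant
`ν(B) − #{σ > 0}`): every inertia jump of the word at a root is mirrored by the opposite jump of the dual; for PSD
letters around a pivot `J`, `ν(F(x)) = ν(J) − R + π(𝔻(x))`.  PROOF: Haynsworth's additivity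
(`GramDual.negIndex_fromBlocks_eq`) applied to the bordered matrix `[[x^eB, U],[Uᵀ, −D⁻¹]]` (`D = diag(σx^δ)`) through
BOTH diagonal blocks: the Schur complement of `x^eB` is `−x^{−E}·𝔻`, that of `−D⁻¹` is `F`; inertia of a diagonal
matrix = sign count (`negIndex_diagonal`), invariance under re-indexing (`negIndex_submatrix_swap`) and positive
scaling (tree `Inertia.negIndex_smul_pos`).  [folklore] (Haynsworth).  Axioms `propext`, `Classical.choice`,
`Quot.sound`.
-/

-- layout Summits/ValiantsHypothesis/ValiantsHypothesis forces the duplicated namespace component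
set_option linter.dupNamespace false

namespace Summit.ValiantsHypothesis.ValiantsHypothesis.Theorems.LacunarySymmetroidMatrixDescartes

open Matrix Finset
open scoped BigOperators

namespace GramDual

variable {ι ρ : Type} [Fintype ι] [DecidableEq ι] [Fintype ρ] [DecidableEq ρ]

/-! ## §1  Inertia of diagonal matrices and re-indexing -/

omit [Fintype ι] [DecidableEq ι] in
/-- **`ν(diag w) = #{j : w_j < 0}`.** [folklore] -/
theorem negIndex_diagonal (w : ρ → ℝ) (hW : (Matrix.diagonal w).IsHermitian) :
    Fintype.card {j // hW.eigenvalues j < 0} = Fintype.card {j // w j < 0} := by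
  classical
  have hform : ∀ c : ρ → ℝ, c ⬝ᵥ (Matrix.diagonal w *ᵥ c) = ∑ j, w j * c j ^ 2 := by
    intro c
    simp only [Matrix.mulVec_diagonal, dotProduct]
    refine Finset.sum_congr rfl fun j _ => ?_
    ring
  have hstd : ∀ {q : ρ → Prop} (c : {j // q j} → ℝ) (k : ρ),
      (∑ i, c i • (Pi.single (i.1 : ρ) (1 : ℝ) : ρ → ℝ)) k = if h : q k then c ⟨k, h⟩ else 0 := by
    intro q c k
    rw [Finset.sum_apply]
    simp only [Pi.smul_apply, Pi.single_apply, smul_eq_mul, mul_ite, mul_one, mul_zero]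
    split_ifs with hk
    · rw [Finset.sum_eq_single ⟨k, hk⟩ (fun i _ hi => if_neg fun h => hi (Subtype.ext h.symm)) (by simp)]
      simp
    · exact Finset.sum_eq_zero fun i _ => if_neg fun (h : k = (i : ρ)) => hk (h ▸ i.2)
  apply le_antisymm
  · -- `ν ≤ #neg`: the standard vectors at `w_j ≥ 0` form an independent non-negative family
    have h := Inertia.card_add_card_le (Matrix.diagonal w) _
      (fun i : {j // 0 ≤ w j} => (Pi.single (i.1 : ρ) (1 : ℝ) : ρ → ℝ)) (Inertia.neg_eigenFamily hW)
      (by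
        rw [Fintype.linearIndependent_iff]
        intro c hc i
        have := congrFun hc i.1
        rw [hstd c i.1, dif_pos i.2] at this
        simpa using this)
      (fun c => by
        rw [hform]
        refine Finset.sum_nonneg fun k _ => ?_
        rw [hstd c k]
        split_ifs with hk
        · exact mul_nonneg hk (sq_nonneg _)
        · simp)
    have hc : Fintype.card {j // 0 ≤ w j} = Fintype.card ρ - Fintype.card {j // w j < 0} := by
      have hh : (fun j => 0 ≤ w j) = fun j => ¬ (w j < 0) := by funext j; exact propext not_lt.symm
      simp only [hh]
      exact Fintype.card_subtype_compl _
    have hle : Fintype.card {j // w j < 0} ≤ Fintype.card ρ := Fintype.card_subtype_le _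
    omega
  · -- `#neg ≤ ν`: the standard vectors at `w_j < 0` form a negative family
    refine Inertia.card_le_negIndex hW (fun i : {j // w j < 0} => (Pi.single (i.1 : ρ) (1 : ℝ) : ρ → ℝ))
      fun c hc => ?_
    rw [hform]
    obtain ⟨i₀, hi₀⟩ : ∃ i, c i ≠ 0 := by
      by_contra h
      push Not at h
      exact hc (funext h)
    have hlt : w i₀.1 * (∑ i, c i • (Pi.single (i.1 : ρ) (1 : ℝ) : ρ → ℝ)) i₀.1 ^ 2 < 0 := by
      rw [hstd c i₀.1, dif_pos i₀.2]
      exact mul_neg_of_neg_of_pos i₀.2 (by positivity)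
    calc ∑ j, w j * (∑ i, c i • (Pi.single (i.1 : ρ) (1 : ℝ) : ρ → ℝ)) j ^ 2
        < ∑ j, (0 : ℝ) := by
          refine Finset.sum_lt_sum (fun k _ => ?_) ⟨i₀.1, Finset.mem_univ _, hlt⟩
          rw [hstd c k]
          split_ifs with hk
          · exact mul_nonpos_of_nonpos_of_nonneg hk.le (sq_nonneg _)
          · simp
      _ = 0 := Finset.sum_const_zero

omit [Fintype ι] [DecidableEq ι] in
/-- **`π(diag w) = #{j : 0 < w_j}`.** [folklore] -/
theorem posIndex_diagonal (w : ρ → ℝ) (hW : (Matrix.diagonal w).IsHermitian) :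
    Fintype.card {j // 0 < hW.eigenvalues j} = Fintype.card {j // 0 < w j} := by
  have hnW : (-Matrix.diagonal w).IsHermitian := hW.neg
  have hnW' : (Matrix.diagonal (fun i => -w i)).IsHermitian := by rw [← Matrix.diagonal_neg]; exact hnW
  rw [← negIndex_neg_eq_posIndex hW hnW, Inertia.negIndex_congr hnW hnW' (Matrix.diagonal_neg w),
    negIndex_diagonal (fun i => -w i) hnW']
  simp only [neg_lt_zero]

/-- **Inertia is invariant under the block swap** `[[A,B],[C,D]] ↦ [[D,C],[B,A]]`. [folklore] -/
theorem negIndex_submatrix_swap {M : Matrix (ι ⊕ ρ) (ι ⊕ ρ) ℝ} (hM : M.IsHermitian)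
    (hM' : (M.submatrix Sum.swap Sum.swap).IsHermitian) :
    Fintype.card {j // hM'.eigenvalues j < 0} = Fintype.card {j // hM.eigenvalues j < 0} := by
  classical
  have hform : ∀ v : ρ ⊕ ι → ℝ,
      v ⬝ᵥ (M.submatrix Sum.swap Sum.swap *ᵥ v) = (v ∘ Sum.swap) ⬝ᵥ (M *ᵥ (v ∘ Sum.swap)) := by
    intro v
    simp only [dotProduct, Matrix.mulVec, Matrix.submatrix_apply, Function.comp_apply]
    symm
    refine Fintype.sum_equiv (Equiv.sumComm ι ρ) _ _ (fun a => ?_)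
    simp only [Equiv.sumComm_apply, Sum.swap_swap]
    congr 1
    refine Fintype.sum_equiv (Equiv.sumComm ι ρ) _ _ (fun b => ?_)
    simp only [Equiv.sumComm_apply, Sum.swap_swap]
  have hform' : ∀ v : ι ⊕ ρ → ℝ,
      v ⬝ᵥ (M *ᵥ v) = (v ∘ Sum.swap) ⬝ᵥ (M.submatrix Sum.swap Sum.swap *ᵥ (v ∘ Sum.swap)) := by
    intro v
    have h := hform (v ∘ Sum.swap)
    have hv : (v ∘ Sum.swap) ∘ Sum.swap = v := funext fun s => by simp only [Function.comp_apply, Sum.swap_swap]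
    rw [hv] at h
    exact h.symm
  apply le_antisymm
  · refine Inertia.card_le_negIndex hM (fun i : {j // hM'.eigenvalues j < 0} => (hM'.eigenvectorBasis i.1).ofLp ∘ Sum.swap)
      fun c hc => ?_
    have h := Inertia.neg_eigenFamily hM' c hc
    rw [hform] at h
    have hsum : (∑ i, c i • ((hM'.eigenvectorBasis i.1).ofLp ∘ Sum.swap))
        = (∑ i, c i • (hM'.eigenvectorBasis i.1).ofLp) ∘ Sum.swap := by
      funext s; simp only [Finset.sum_apply, Pi.smul_apply, Function.comp_apply]
    rw [hsum]
    exact h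
  · refine Inertia.card_le_negIndex hM' (fun i : {j // hM.eigenvalues j < 0} => (hM.eigenvectorBasis i.1).ofLp ∘ Sum.swap)
      fun c hc => ?_
    have h := Inertia.neg_eigenFamily hM c hc
    rw [hform'] at h
    have hsum : (∑ i, c i • ((hM.eigenvectorBasis i.1).ofLp ∘ Sum.swap))
        = (∑ i, c i • (hM.eigenvectorBasis i.1).ofLp) ∘ Sum.swap := by
      funext s; simp only [Finset.sum_apply, Pi.smul_apply, Function.comp_apply]
    rw [hsum]
    exact h

/-! ## §2  The bordered matrix of a word and its two Schur complements -/

/-- `(c • A)⁻¹ = c⁻¹ • A⁻¹` for `c ≠ 0`, `det A ≠ 0`. [folklore] -/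
theorem inv_smul_eq {A : Matrix ι ι ℝ} (hA : IsUnit A.det) {c : ℝ} (hc : c ≠ 0) : (c • A)⁻¹ = c⁻¹ • A⁻¹ :=
  Matrix.inv_eq_right_inv (by rw [Matrix.smul_mul, Matrix.mul_smul, smul_smul, mul_inv_cancel₀ hc, one_smul,
    Matrix.mul_nonsing_inv _ hA])

omit [Fintype ι] [DecidableEq ι] in
/-- The inverse diagonal: `(−diag((σx^δ)⁻¹))⁻¹ = −diag(σx^δ)`. [folklore] -/
theorem inv_neg_diagInv (σ : ρ → ℝ) (hσ : ∀ j, σ j ≠ 0) (δ : ρ → ℕ) {x : ℝ} (hx : x ≠ 0) :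
    (-Matrix.diagonal (fun j => (σ j * x ^ δ j)⁻¹))⁻¹ = -Matrix.diagonal (fun j => σ j * x ^ δ j) :=
  Matrix.inv_eq_right_inv (by
    rw [neg_mul_neg, Matrix.diagonal_mul_diagonal, ← Matrix.diagonal_one]
    congr 1
    funext j
    exact inv_mul_cancel₀ (mul_ne_zero (hσ j) (pow_ne_zero _ hx)))

omit [Fintype ρ] in
/-- Schur complement of the base block: `−diag((σx^δ)⁻¹) − Uᵀ(x^eB)⁻¹U = −(x^E)⁻¹ • 𝔻(x)`. [folklore] -/
theorem schur_base_eq {B : Matrix ι ι ℝ} (hB : IsUnit B.det) (U : Matrix ι ρ ℝ) (σ : ρ → ℝ) (hσ : ∀ j, σ j ≠ 0)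
    (e E : ℕ) (δ : ρ → ℕ) (he : e ≤ E) (hδ : ∀ j, δ j ≤ E) {x : ℝ} (hx : 0 < x) :
    -Matrix.diagonal (fun j => (σ j * x ^ δ j)⁻¹) - Uᵀ * (x ^ e • B)⁻¹ * U
      = -((x ^ E)⁻¹ • (Matrix.diagonal (fun j => (σ j)⁻¹ * x ^ (E - δ j)) + x ^ (E - e) • (Uᵀ * B⁻¹ * U))) := by
  have hxne : x ≠ 0 := hx.ne'
  rw [inv_smul_eq hB (pow_ne_zero _ hxne), Matrix.mul_smul, Matrix.smul_mul]
  have h1 : Matrix.diagonal (fun j => (σ j * x ^ δ j)⁻¹)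
      = (x ^ E)⁻¹ • Matrix.diagonal (fun j => (σ j)⁻¹ * x ^ (E - δ j)) := by
    rw [← Matrix.diagonal_smul]
    congr 1
    funext j
    simp only [Pi.smul_apply, smul_eq_mul]
    rw [pow_sub₀ _ hxne (hδ j)]
    have hσj := hσ j
    have hxE : x ^ E ≠ 0 := pow_ne_zero _ hxne
    have hxδ : x ^ δ j ≠ 0 := pow_ne_zero _ hxne
    field_simp
  have h2 : (x ^ e)⁻¹ = (x ^ E)⁻¹ * x ^ (E - e) := by
    rw [pow_sub₀ _ hxne he]
    have hxE : x ^ E ≠ 0 := pow_ne_zero _ hxne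
    have hxe : x ^ e ≠ 0 := pow_ne_zero _ hxne
    field_simp
  rw [h1, h2, ← smul_smul, smul_add, neg_add, sub_eq_add_neg]


/-! ## §3  The inertia duality -/

/-- Positive-index version of the swap invariance. [folklore] -/
theorem posIndex_submatrix_swap {M : Matrix (ι ⊕ ρ) (ι ⊕ ρ) ℝ} (hM : M.IsHermitian)
    (hM' : (M.submatrix Sum.swap Sum.swap).IsHermitian) :
    Fintype.card {j // 0 < hM'.eigenvalues j} = Fintype.card {j // 0 < hM.eigenvalues j} := by
  have hnM : (-M).IsHermitian := hM.neg
  have hnM' : (-(M.submatrix Sum.swap Sum.swap)).IsHermitian := hM'.neg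
  have hnMs : ((-M).submatrix Sum.swap Sum.swap).IsHermitian := hnM.submatrix _
  have hneg : (-M).submatrix Sum.swap Sum.swap = -(M.submatrix Sum.swap Sum.swap) := by
    rw [Matrix.submatrix_neg]; rfl
  rw [← negIndex_neg_eq_posIndex hM' hnM', ← negIndex_neg_eq_posIndex hM hnM,
    Inertia.negIndex_congr hnM' hnMs hneg.symm]
  exact negIndex_submatrix_swap hnM hnMs

/-- **THE INERTIA DUALITY (negative index).**  `B` symmetric, `det B ≠ 0`, `σⱼ ≠ 0`, `e, δⱼ ≤ E`, `x > 0`: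
`ν(x^eB + U diag(σx^δ) Uᵀ) + #{j : 0 < σⱼ} = ν(B) + π(diag(σ⁻¹x^{E−δ}) + x^{E−e}·UᵀB⁻¹U)`. [folklore] -/
theorem negIndex_word_add_eq {B : Matrix ι ι ℝ} (hBs : B.IsSymm) (hBu : IsUnit B.det) (U : Matrix ι ρ ℝ)
    (σ : ρ → ℝ) (hσ : ∀ j, σ j ≠ 0) (e E : ℕ) (δ : ρ → ℕ) (he : e ≤ E) (hδ : ∀ j, δ j ≤ E) {x : ℝ} (hx : 0 < x)
    (hB : B.IsHermitian)
    (hF : (x ^ e • B + U * Matrix.diagonal (fun j => σ j * x ^ δ j) * Uᵀ).IsHermitian)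
    (hD : (Matrix.diagonal (fun j => (σ j)⁻¹ * x ^ (E - δ j)) + x ^ (E - e) • (Uᵀ * B⁻¹ * U)).IsHermitian) :
    Fintype.card {j // hF.eigenvalues j < 0} + Fintype.card {j // 0 < σ j}
      = Fintype.card {j // hB.eigenvalues j < 0} + Fintype.card {j // 0 < hD.eigenvalues j} := by
  classical
  have hxne : x ≠ 0 := hx.ne'
  -- the blocks
  set A : Matrix ι ι ℝ := x ^ e • B with hAdef
  set A' : Matrix ρ ρ ℝ := -Matrix.diagonal (fun j => (σ j * x ^ δ j)⁻¹) with hA'def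
  set Dl : Matrix ρ ρ ℝ := Matrix.diagonal (fun j => (σ j)⁻¹ * x ^ (E - δ j)) + x ^ (E - e) • (Uᵀ * B⁻¹ * U)
    with hDldef
  have hAs : A.IsSymm := hBs.smul _
  have hAH : A.IsHermitian := Matrix.isHermitian_iff_isSymm.2 hAs
  have hAu : IsUnit A.det := by
    rw [hAdef, Matrix.det_smul, isUnit_iff_ne_zero]
    exact mul_ne_zero (pow_ne_zero _ (pow_ne_zero _ hxne)) hBu.ne_zero
  have hA's : A'.IsSymm := (Matrix.isSymm_diagonal _).neg
  have hA'H : A'.IsHermitian := Matrix.isHermitian_iff_isSymm.2 hA's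
  have hA'u : IsUnit A'.det := by
    rw [hA'def, Matrix.det_neg, Matrix.det_diagonal, isUnit_iff_ne_zero]
    exact mul_ne_zero (pow_ne_zero _ (by norm_num))
      (Finset.prod_ne_zero_iff.2 fun j _ => inv_ne_zero (mul_ne_zero (hσ j) (pow_ne_zero _ hxne)))
  have hDls : Dl.IsSymm := Matrix.isHermitian_iff_isSymm.1 hD
  -- the bordered matrix
  have hUt : Uᴴ = Uᵀ := Matrix.conjTranspose_eq_transpose_of_trivial U
  have hM : (Matrix.fromBlocks A U Uᵀ A').IsHermitian := Matrix.IsHermitian.fromBlocks hAH hUt hA'H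
  -- Schur complement of the base block
  have hS₁eq : A' - Uᵀ * A⁻¹ * U = -((x ^ E)⁻¹ • Dl) := schur_base_eq hBu U σ hσ e E δ he hδ hx
  have hcDls : ((x ^ E)⁻¹ • Dl).IsSymm := hDls.smul _
  have hcDlH : ((x ^ E)⁻¹ • Dl).IsHermitian := Matrix.isHermitian_iff_isSymm.2 hcDls
  have hncDlH : (-((x ^ E)⁻¹ • Dl)).IsHermitian := hcDlH.neg
  have hS₁ : (A' - Uᵀ * A⁻¹ * U).IsHermitian := by rw [hS₁eq]; exact hncDlH
  have h1 := negIndex_fromBlocks_eq hAs hAu U A' hAH hS₁ hM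
  have hνA : Fintype.card {j // hAH.eigenvalues j < 0} = Fintype.card {j // hB.eigenvalues j < 0} :=
    Inertia.negIndex_smul_pos hB (pow_pos hx e) hAH
  have hνS₁ : Fintype.card {j // hS₁.eigenvalues j < 0} = Fintype.card {j // 0 < hD.eigenvalues j} := by
    rw [Inertia.negIndex_congr hS₁ hncDlH hS₁eq, negIndex_neg_eq_posIndex hcDlH hncDlH,
      Inertia.posIndex_smul_pos hD (inv_pos.2 (pow_pos hx E)) hcDlH]
  -- the swapped bordered matrix and the Schur complement of the diagonal block
  have hMswap : (Matrix.fromBlocks A U Uᵀ A').submatrix Sum.swap Sum.swap = Matrix.fromBlocks A' Uᵀ Uᵀᵀ A := by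
    rw [Matrix.fromBlocks_submatrix_sum_swap_sum_swap, Matrix.transpose_transpose]
  have hMsub : ((Matrix.fromBlocks A U Uᵀ A').submatrix Sum.swap Sum.swap).IsHermitian := hM.submatrix _
  have hM2 : (Matrix.fromBlocks A' Uᵀ Uᵀᵀ A).IsHermitian := by rw [← hMswap]; exact hMsub
  have hS₂eq : A - Uᵀᵀ * A'⁻¹ * Uᵀ = x ^ e • B + U * Matrix.diagonal (fun j => σ j * x ^ δ j) * Uᵀ := by
    rw [Matrix.transpose_transpose, hA'def, inv_neg_diagInv σ hσ δ hxne, Matrix.mul_neg, Matrix.neg_mul,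
      sub_neg_eq_add]
  have hS₂ : (A - Uᵀᵀ * A'⁻¹ * Uᵀ).IsHermitian := by rw [hS₂eq]; exact hF
  have h2 := negIndex_fromBlocks_eq hA's hA'u Uᵀ A hA'H hS₂ hM2
  have hνM2 : Fintype.card {j // hM2.eigenvalues j < 0} = Fintype.card {j // hM.eigenvalues j < 0} := by
    rw [← Inertia.negIndex_congr hMsub hM2 hMswap]
    exact negIndex_submatrix_swap hM hMsub
  have hνA' : Fintype.card {j // hA'H.eigenvalues j < 0} = Fintype.card {j // 0 < σ j} := by
    have hA'd : (Matrix.diagonal (fun j => -(σ j * x ^ δ j)⁻¹)).IsHermitian := by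
      rw [← Matrix.diagonal_neg]; exact hA'H
    rw [Inertia.negIndex_congr hA'H hA'd (Matrix.diagonal_neg _), negIndex_diagonal _ hA'd]
    refine Fintype.card_congr (Equiv.subtypeEquivRight fun j => ?_)
    rw [neg_lt_zero, inv_pos]
    constructor
    · intro h
      exact pos_of_mul_pos_left h (pow_pos hx _).le |> fun h' => by
        rcases lt_trichotomy (σ j) 0 with hl | hz | hp
        · exact absurd h (not_lt.2 (mul_nonpos_of_nonpos_of_nonneg hl.le (pow_pos hx _).le))
        · exact absurd hz (hσ j)
        · exact hp
    · intro h
      exact mul_pos h (pow_pos hx _)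
  have hνS₂ : Fintype.card {j // hS₂.eigenvalues j < 0} = Fintype.card {j // hF.eigenvalues j < 0} :=
    Inertia.negIndex_congr hS₂ hF hS₂eq
  -- assemble
  rw [hνA, hνS₁] at h1
  rw [hνM2, hνA', hνS₂] at h2
  omega

/-- **THE INERTIA DUALITY (positive index).**  Same hypotheses:
`π(x^eB + U diag(σx^δ) Uᵀ) + #{j : σⱼ < 0} = π(B) + ν(diag(σ⁻¹x^{E−δ}) + x^{E−e}·UᵀB⁻¹U)`. [folklore] -/
theorem posIndex_word_add_eq {B : Matrix ι ι ℝ} (hBs : B.IsSymm) (hBu : IsUnit B.det) (U : Matrix ι ρ ℝ)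
    (σ : ρ → ℝ) (hσ : ∀ j, σ j ≠ 0) (e E : ℕ) (δ : ρ → ℕ) (he : e ≤ E) (hδ : ∀ j, δ j ≤ E) {x : ℝ} (hx : 0 < x)
    (hB : B.IsHermitian)
    (hF : (x ^ e • B + U * Matrix.diagonal (fun j => σ j * x ^ δ j) * Uᵀ).IsHermitian)
    (hD : (Matrix.diagonal (fun j => (σ j)⁻¹ * x ^ (E - δ j)) + x ^ (E - e) • (Uᵀ * B⁻¹ * U)).IsHermitian) :
    Fintype.card {j // 0 < hF.eigenvalues j} + Fintype.card {j // σ j < 0}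
      = Fintype.card {j // 0 < hB.eigenvalues j} + Fintype.card {j // hD.eigenvalues j < 0} := by
  classical
  have hxne : x ≠ 0 := hx.ne'
  set A : Matrix ι ι ℝ := x ^ e • B with hAdef
  set A' : Matrix ρ ρ ℝ := -Matrix.diagonal (fun j => (σ j * x ^ δ j)⁻¹) with hA'def
  set Dl : Matrix ρ ρ ℝ := Matrix.diagonal (fun j => (σ j)⁻¹ * x ^ (E - δ j)) + x ^ (E - e) • (Uᵀ * B⁻¹ * U)
    with hDldef
  have hAs : A.IsSymm := hBs.smul _
  have hAH : A.IsHermitian := Matrix.isHermitian_iff_isSymm.2 hAs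
  have hAu : IsUnit A.det := by
    rw [hAdef, Matrix.det_smul, isUnit_iff_ne_zero]
    exact mul_ne_zero (pow_ne_zero _ (pow_ne_zero _ hxne)) hBu.ne_zero
  have hA's : A'.IsSymm := (Matrix.isSymm_diagonal _).neg
  have hA'H : A'.IsHermitian := Matrix.isHermitian_iff_isSymm.2 hA's
  have hA'u : IsUnit A'.det := by
    rw [hA'def, Matrix.det_neg, Matrix.det_diagonal, isUnit_iff_ne_zero]
    exact mul_ne_zero (pow_ne_zero _ (by norm_num))
      (Finset.prod_ne_zero_iff.2 fun j _ => inv_ne_zero (mul_ne_zero (hσ j) (pow_ne_zero _ hxne)))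
  have hDls : Dl.IsSymm := Matrix.isHermitian_iff_isSymm.1 hD
  have hUt : Uᴴ = Uᵀ := Matrix.conjTranspose_eq_transpose_of_trivial U
  have hM : (Matrix.fromBlocks A U Uᵀ A').IsHermitian := Matrix.IsHermitian.fromBlocks hAH hUt hA'H
  have hS₁eq : A' - Uᵀ * A⁻¹ * U = -((x ^ E)⁻¹ • Dl) := schur_base_eq hBu U σ hσ e E δ he hδ hx
  have hcDls : ((x ^ E)⁻¹ • Dl).IsSymm := hDls.smul _
  have hcDlH : ((x ^ E)⁻¹ • Dl).IsHermitian := Matrix.isHermitian_iff_isSymm.2 hcDls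
  have hncDlH : (-((x ^ E)⁻¹ • Dl)).IsHermitian := hcDlH.neg
  have hnncDlH : (-(-((x ^ E)⁻¹ • Dl))).IsHermitian := hncDlH.neg
  have hS₁ : (A' - Uᵀ * A⁻¹ * U).IsHermitian := by rw [hS₁eq]; exact hncDlH
  have h1 := posIndex_fromBlocks_eq hAs hAu U A' hAH hS₁ hM
  have hπA : Fintype.card {j // 0 < hAH.eigenvalues j} = Fintype.card {j // 0 < hB.eigenvalues j} :=
    Inertia.posIndex_smul_pos hB (pow_pos hx e) hAH
  have hπS₁ : Fintype.card {j // 0 < hS₁.eigenvalues j} = Fintype.card {j // hD.eigenvalues j < 0} := by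
    rw [Inertia.posIndex_congr hS₁ hncDlH hS₁eq, ← negIndex_neg_eq_posIndex hncDlH hnncDlH,
      Inertia.negIndex_congr hnncDlH hcDlH (neg_neg _), Inertia.negIndex_smul_pos hD (inv_pos.2 (pow_pos hx E)) hcDlH]
  have hMswap : (Matrix.fromBlocks A U Uᵀ A').submatrix Sum.swap Sum.swap = Matrix.fromBlocks A' Uᵀ Uᵀᵀ A := by
    rw [Matrix.fromBlocks_submatrix_sum_swap_sum_swap, Matrix.transpose_transpose]
  have hMsub : ((Matrix.fromBlocks A U Uᵀ A').submatrix Sum.swap Sum.swap).IsHermitian := hM.submatrix _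
  have hM2 : (Matrix.fromBlocks A' Uᵀ Uᵀᵀ A).IsHermitian := by rw [← hMswap]; exact hMsub
  have hS₂eq : A - Uᵀᵀ * A'⁻¹ * Uᵀ = x ^ e • B + U * Matrix.diagonal (fun j => σ j * x ^ δ j) * Uᵀ := by
    rw [Matrix.transpose_transpose, hA'def, inv_neg_diagInv σ hσ δ hxne, Matrix.mul_neg, Matrix.neg_mul,
      sub_neg_eq_add]
  have hS₂ : (A - Uᵀᵀ * A'⁻¹ * Uᵀ).IsHermitian := by rw [hS₂eq]; exact hF
  have h2 := posIndex_fromBlocks_eq hA's hA'u Uᵀ A hA'H hS₂ hM2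
  have hπM2 : Fintype.card {j // 0 < hM2.eigenvalues j} = Fintype.card {j // 0 < hM.eigenvalues j} := by
    rw [← Inertia.posIndex_congr hMsub hM2 hMswap]
    exact posIndex_submatrix_swap hM hMsub
  have hπA' : Fintype.card {j // 0 < hA'H.eigenvalues j} = Fintype.card {j // σ j < 0} := by
    have hA'd : (Matrix.diagonal (fun j => -(σ j * x ^ δ j)⁻¹)).IsHermitian := by
      rw [← Matrix.diagonal_neg]; exact hA'H
    rw [Inertia.posIndex_congr hA'H hA'd (Matrix.diagonal_neg _), posIndex_diagonal _ hA'd]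
    refine Fintype.card_congr (Equiv.subtypeEquivRight fun j => ?_)
    rw [neg_pos, inv_lt_zero]
    constructor
    · intro h
      rcases lt_trichotomy (σ j) 0 with hl | hz | hp
      · exact hl
      · exact absurd hz (hσ j)
      · exact absurd h (not_lt.2 (mul_pos hp (pow_pos hx _)).le)
    · intro h
      exact mul_neg_of_neg_of_pos h (pow_pos hx _)
  have hπS₂ : Fintype.card {j // 0 < hS₂.eigenvalues j} = Fintype.card {j // 0 < hF.eigenvalues j} :=
    Inertia.posIndex_congr hS₂ hF hS₂eq
  rw [hπA, hπS₁] at h1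
  rw [hπM2, hπA', hπS₂] at h2
  omega

end GramDual

end Summit.ValiantsHypothesis.ValiantsHypothesis.Theorems.LacunarySymmetroidMatrixDescartes
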